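import Literature.Topology.FourManifolds.HomotopySpheresStablyParallelizableHomotopyGroup
import Literature.Topology.FourManifolds.HomotopySpheresStablyParallelizableGramSchmidt
import HarnessLib

/-!
# `Bott1959_sphereMapsToStableFramesExtend_six` is exactly `π₆(SO(8), 1) = 0`

Topic `Literature/Topology/FourManifolds`, third sibling of
`HomotopySpheresStablyParallelizable.lean`, whose named fact
`Literature.Topology.FourManifolds.Bott1959_sphereMapsToStableFramesExtend_six` (every
continuous map from `𝕊⁶` to the stable frames of `ℝ⁷` — linearly independent `8`-families of
`ℝ⁷ × ℝ`, a copy of `GL(8, ℝ)` — extends over `ℝ⁷`; the input of Case 1 of Kervaire–Milnor's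
proof of Thm. 3.1 at `n = 7`) is here PROVED equivalent to the printed statement

  `Bott1959_sphereMapsToStableFramesExtend_six ↔ Subsingleton (π_ 6 SO(8) 1)`

(`Literature.Topology.FourManifolds.Bott1959_sphereMapsToStableFramesExtend_six_iff_specialOrthogonalGroup`),
with `SO(8) = Matrix.specialOrthogonalGroup (Fin 8) ℝ` (Mathlib: `Aᵀ A = A Aᵀ = 1`, `det A = 1`,
subspace topology of `M₈(ℝ)`), base point `1`, and `π_ 6 = HomotopyGroup (Fin 6)`. This completes
the elementary translation recorded informally in the docstring of the named fact (the siblings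
`…HomotopyGroup.lean` — extension iff null-homotopic, `π_ n` of `StableFrame` — and
`…GramSchmidt.lean` — the Gram–Schmidt retraction of Hatcher, *Algebraic Topology*, §3.D — are
the first two steps). What remains unproved is exactly `π₆(SO(8)) = 0`: Bott 1959, §1, Corollary
to Thm. II, (1.5) `πₖ(O) = πₖ₊₄(Sp)` with `π₂(Sp) = 0` ("In the case of `Sp`, one has the groups
`0, 0, 0, ℤ` for `k = 0, 1, 2, 3` … Hence the period of `π_*(O)` is `ℤ₂, ℤ₂, 0, ℤ, 0, 0, 0, ℤ`",
p. 315), with the stability `π₆(SO(8)) ≅ π₆(SO)` (Kosinski, *Differential Manifolds*, Appendix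
§5, p. 230, table (5.1); Kervaire–Milnor p. 508).

Contents (everything proved; no definitions, no named facts), for general `n ≥ 1` and `N`, as
implications between the properties "every continuous map `X → ·` is null-homotopic":

* §4 linearly independent `N`-families of `ℝᴺ` ↔ `O(N)` (any `X`): the Gram–Schmidt homotopy,
  and a null-homotopy read back on columns / orthonormalised along the way.
* §5 `O(N)` ↔ `SO(N)` (`X` preconnected, nonempty): base at `1` by a left translation; the
  determinant is locally constant (`det_eq_one_of_preconnectedSpace`) on `X` and on `I × X`.
* §6 on `X = 𝕊ⁿ`: `SO(N)` ↔ `Subsingleton (π_ n SO(N) 1)` — left translations make all base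
  points of `SO(N)` alike; a map based at `1` lands in the path component of `1`, where Hatcher's
  criterion (3) ⇒ (1) for `πₙ = 0` (§4.1, p. 346; the tree's
  `homotopic_const_of_sphere_of_subsingleton_homotopyGroup`) applies; conversely
  `subsingleton_homotopyGroup_of_sphereMaps_nullhomotopic`.
* §7 `StableFrame m` ↔ linearly independent `(m + 1)`-families of `ℝᵐ⁺¹` (any `X`; a linear
  homeomorphism `ℝᵐ × ℝ ≅ ℝᵐ⁺¹`).
* §8 `Literature.Topology.FourManifolds.sphereMapsToStableFramesExtend_iff_subsingleton_homotopyGroup_specialOrthogonalGroup`: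
  `SphereMapsToStableFramesExtend n ↔ Subsingleton (π_ n SO(n + 2) 1)` (`n ≥ 1`), and `n = 6`.

NOT proved here (why the named fact stays a named fact): `π₆(SO(8), 1) = 0` itself — Bott
periodicity, or the unstable ladder `SO(3) ⊂ ⋯ ⊂ SO(8)` through `π₆(S³) = ℤ₁₂`, and the exact
sequences of the fibrations `SO(k) → SO(k + 1) → Sᵏ`, are absent from Mathlib and from the tree.

## References

* R. Bott, *The stable homotopy of the classical groups*, Ann. of Math. (2) 70 (1959), 313–337:
  §1, Corollary to Theorem II, (1.5) and the sentence after it, p. 315. doi:10.2307/1970106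
  [Bott1959]
* M. Kervaire, J. Milnor, *Groups of homotopy spheres I*, Ann. of Math. (2) 77 (1963), §3, proof
  of Thm. 3.1, p. 508 (Case 1; "`πₙ₋₁(SO_{n+1})` may be identified with the stable group").
  [KervaireMilnorAnnals1963]
* A. Kosinski, *Differential Manifolds* (1993), Appendix §5, (5.1) and p. 230. [Kosinski1993]
* A. Hatcher, *Algebraic Topology*, CUP (2002), §3.D (`O(n)` is a deformation retract of
  `GLₙ(ℝ)`); §4.1, p. 346 (conditions (1)–(3) for `πᵢ = 0`), p. 341 (base points). [HatcherAT2002]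
-/
noncomputable section

namespace Literature.Topology.FourManifolds

open Literature.AlgebraicTopology.Homotopy InnerProductSpace Matrix
open scoped _root_.Topology _root_.Topology.Homotopy unitInterval RealInnerProductSpace
open Set Metric

/-! ### 4. Null-homotopy of maps into linearly independent families versus into `O(N)` -/

section Orthogonal

variable {N : ℕ} {X : Type*} [TopologicalSpace X]

/-- **If every continuous map `X → O(N)` is null-homotopic, so is every continuous map from `X`
to the linearly independent `N`-families of `ℝᴺ`**: the given map is homotopic through linearly
independent families to its Gram–Schmidt orthonormalisation (`homotopic_gramSchmidtNormed`),
which is the column family of an `O(N)`-valued map; a null-homotopy of the latter, read back on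
columns, finishes (Hatcher §3.D: `O(n)` is a deformation retract of `GLₙ(ℝ)`, so the two have
the same homotopy type). [cite: HatcherAT2002, §3.D (O(n) is a deformation retract of GLₙ(ℝ))] -/
theorem nullhomotopic_linearIndependent_of_orthogonalGroup
    (h : ∀ k : C(X, Matrix.orthogonalGroup (Fin N) ℝ), k.Nullhomotopic)
    (g : C(X, {f : Fin N → EuclideanSpace ℝ (Fin N) // LinearIndependent ℝ f})) :
    g.Nullhomotopic := by
  obtain ⟨g', hg', hgg'⟩ := homotopic_gramSchmidtNormed g
  -- the orthogonal-matrix-valued map `k = matrix ∘ GS ∘ g`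
  have hk : Continuous fun x => (Matrix.of fun i j => (g' x).1 j i) :=
    continuous_matrixOfFamily.comp (continuous_subtype_val.comp g'.continuous)
  have hkO : ∀ x, (Matrix.of fun i j => (g' x).1 j i) ∈ Matrix.orthogonalGroup (Fin N) ℝ := by
    intro x
    rw [hg' x]
    exact mem_orthogonalGroup_of_orthonormal (gramSchmidtNormed_orthonormal (g x).2)
  let k : C(X, Matrix.orthogonalGroup (Fin N) ℝ) := ⟨fun x => ⟨_, hkO x⟩, hk.subtype_mk _⟩
  -- the way back: columns of an orthogonal matrix
  let fam : C(Matrix.orthogonalGroup (Fin N) ℝ,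
      {f : Fin N → EuclideanSpace ℝ (Fin N) // LinearIndependent ℝ f}) :=
    ⟨fun A => ⟨fun j => WithLp.toLp 2 fun i => A.1 i j,
        (orthonormal_of_mem_orthogonalGroup A.2).linearIndependent⟩,
      (continuous_familyOfMatrix.comp continuous_subtype_val).subtype_mk _⟩
  have hfam : fam.comp k = g' := by
    ext x : 2
    rfl
  obtain ⟨A₀, hA₀⟩ := h k
  have h1 : g'.Nullhomotopic := ⟨fam A₀, by
    rw [← hfam]
    exact (ContinuousMap.Homotopic.refl fam).comp hA₀⟩
  obtain ⟨v₀, hv₀⟩ := h1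
  exact ⟨v₀, hgg'.trans hv₀⟩

/-- **Conversely, if every continuous map from `X` to the linearly independent `N`-families of
`ℝᴺ` is null-homotopic, so is every continuous map `X → O(N)`**: apply Gram–Schmidt along a
null-homotopy of the column family and return to matrices; at time `0` this gives back the
orthogonal matrix itself (`gramSchmidtNormed_of_orthonormal`: the retraction is the identity on
`O(N)`, Hatcher §3.D). [cite: HatcherAT2002, §3.D (Gram–Schmidt retraction r : GLₙ(ℝ) → O(n))] -/
theorem nullhomotopic_orthogonalGroup_of_linearIndependent
    (h : ∀ g : C(X, {f : Fin N → EuclideanSpace ℝ (Fin N) // LinearIndependent ℝ f}),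
      g.Nullhomotopic)
    (k : C(X, Matrix.orthogonalGroup (Fin N) ℝ)) : k.Nullhomotopic := by
  let fam : C(Matrix.orthogonalGroup (Fin N) ℝ,
      {f : Fin N → EuclideanSpace ℝ (Fin N) // LinearIndependent ℝ f}) :=
    ⟨fun A => ⟨fun j => WithLp.toLp 2 fun i => A.1 i j,
        (orthonormal_of_mem_orthogonalGroup A.2).linearIndependent⟩,
      (continuous_familyOfMatrix.comp continuous_subtype_val).subtype_mk _⟩
  obtain ⟨v₀, ⟨G⟩⟩ := h (fam.comp k)
  -- Gram–Schmidt and back to matrices, along the null-homotopy `G`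
  have hc : Continuous fun p : I × X => (Matrix.of fun i j => gramSchmidtNormed ℝ (G p).1 j i) :=
    continuous_matrixOfFamily.comp (continuous_gramSchmidtNormed_subtype.comp G.continuous)
  have hO : ∀ p : I × X, (Matrix.of fun i j => gramSchmidtNormed ℝ (G p).1 j i) ∈
      Matrix.orthogonalGroup (Fin N) ℝ := fun p =>
    mem_orthogonalGroup_of_orthonormal (gramSchmidtNormed_orthonormal (G p).2)
  have hv₀O : (Matrix.of fun i j => gramSchmidtNormed ℝ v₀.1 j i) ∈
      Matrix.orthogonalGroup (Fin N) ℝ :=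
    mem_orthogonalGroup_of_orthonormal (gramSchmidtNormed_orthonormal v₀.2)
  refine ⟨⟨_, hv₀O⟩, ⟨?_⟩⟩
  exact
    { toFun := fun p => ⟨_, hO p⟩
      continuous_toFun := hc.subtype_mk _
      map_zero_left := fun x => by
        apply Subtype.ext
        show (Matrix.of fun i j => gramSchmidtNormed ℝ (G (0, x)).1 j i) = (k x).1
        have hG : (G (0, x)).1 =
            fun j => (WithLp.toLp 2 fun i => (k x).1 i j : EuclideanSpace ℝ (Fin N)) := by
          rw [G.apply_zero]; rfl
        rw [hG, gramSchmidtNormed_of_orthonormal (orthonormal_of_mem_orthogonalGroup (k x).2)]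
        ext i j
        rfl
      map_one_left := fun x => by
        apply Subtype.ext
        show (Matrix.of fun i j => gramSchmidtNormed ℝ (G (1, x)).1 j i) =
          Matrix.of fun i j => gramSchmidtNormed ℝ v₀.1 j i
        rw [G.apply_one]
        rfl }

end Orthogonal

/-! ### 5. `O(N)` versus `SO(N)` -/

section SpecialOrthogonal

variable {N : ℕ} {X : Type*} [TopologicalSpace X]

/-- **If every continuous map `X → SO(N)` from a connected nonempty space is null-homotopic, so
is every continuous map `X → O(N)`**: translate the map to take the value `1` at a point; its
determinant, `±1` and continuous, is then `1` everywhere (`det_eq_one_of_preconnectedSpace`), so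
it is an `SO(N)`-valued map, null-homotopic by hypothesis; translate back. (Each path component
of `O(N)` is a translate of `SO(N)`.) [folklore] -/
theorem nullhomotopic_orthogonalGroup_of_specialOrthogonalGroup [PreconnectedSpace X]
    [Nonempty X]
    (h : ∀ k : C(X, Matrix.specialOrthogonalGroup (Fin N) ℝ), k.Nullhomotopic)
    (k : C(X, Matrix.orthogonalGroup (Fin N) ℝ)) : k.Nullhomotopic := by
  let x₀ := Classical.arbitrary X
  let A : Matrix.orthogonalGroup (Fin N) ℝ := k x₀
  let k₁ : C(X, Matrix.orthogonalGroup (Fin N) ℝ) :=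
    ⟨fun x => A⁻¹ * k x, continuous_const.mul k.continuous⟩
  have hk₁ : k₁ x₀ = 1 := inv_mul_cancel A
  have hdet : ∀ x, (k₁ x).1.det = 1 := by
    refine det_eq_one_of_preconnectedSpace (K := fun x => (k₁ x).1)
      (continuous_subtype_val.comp k₁.continuous) (fun x => (k₁ x).2) (t₀ := x₀) ?_
    rw [hk₁]
    exact Matrix.det_one
  let k₂ : C(X, Matrix.specialOrthogonalGroup (Fin N) ℝ) :=
    ⟨fun x => ⟨(k₁ x).1, Matrix.mem_specialOrthogonalGroup_iff.2 ⟨(k₁ x).2, hdet x⟩⟩,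
      (continuous_subtype_val.comp k₁.continuous).subtype_mk _⟩
  let incl : C(Matrix.specialOrthogonalGroup (Fin N) ℝ, Matrix.orthogonalGroup (Fin N) ℝ) :=
    ⟨fun B => ⟨B.1, B.2.1⟩, continuous_subtype_val.subtype_mk _⟩
  have hincl : incl.comp k₂ = k₁ := ContinuousMap.ext fun _ => rfl
  obtain ⟨B₀, hB₀⟩ := h k₂
  have h1 : k₁.Nullhomotopic :=
    ⟨incl B₀, by rw [← hincl]; exact (ContinuousMap.Homotopic.refl incl).comp hB₀⟩
  let L : C(Matrix.orthogonalGroup (Fin N) ℝ, Matrix.orthogonalGroup (Fin N) ℝ) :=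
    ⟨fun B => A * B, continuous_const.mul continuous_id⟩
  have hL : L.comp k₁ = k := ContinuousMap.ext fun x => mul_inv_cancel_left A (k x)
  obtain ⟨C₀, hC₀⟩ := h1
  exact ⟨L C₀, by rw [← hL]; exact (ContinuousMap.Homotopic.refl L).comp hC₀⟩

/-- **If every continuous map `X → O(N)` from a connected nonempty space is null-homotopic, so
is every continuous map `X → SO(N)`**: a null-homotopy in `O(N)` of an `SO(N)`-valued map has
determinant `1` throughout (`I × X` is connected; `det_eq_one_of_preconnectedSpace`), so it is a
null-homotopy in `SO(N)`. [folklore] -/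
theorem nullhomotopic_specialOrthogonalGroup_of_orthogonalGroup [PreconnectedSpace X]
    [Nonempty X]
    (h : ∀ k : C(X, Matrix.orthogonalGroup (Fin N) ℝ), k.Nullhomotopic)
    (k : C(X, Matrix.specialOrthogonalGroup (Fin N) ℝ)) : k.Nullhomotopic := by
  let incl : C(Matrix.specialOrthogonalGroup (Fin N) ℝ, Matrix.orthogonalGroup (Fin N) ℝ) :=
    ⟨fun B => ⟨B.1, B.2.1⟩, continuous_subtype_val.subtype_mk _⟩
  obtain ⟨A₀, ⟨H⟩⟩ := h (incl.comp k)
  let x₀ := Classical.arbitrary X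
  haveI : PreconnectedSpace I := Subtype.preconnectedSpace isPreconnected_Icc
  have hdet : ∀ p : I × X, (H p).1.det = 1 := by
    refine det_eq_one_of_preconnectedSpace (K := fun p => (H p).1)
      (continuous_subtype_val.comp H.continuous) (fun p => (H p).2) (t₀ := ((0 : I), x₀)) ?_
    show (H (0, x₀)).1.det = 1
    rw [H.apply_zero]
    exact (k x₀).2.2
  have hA₀ : A₀.1.det = 1 := by
    have := hdet (1, x₀)
    rwa [H.apply_one] at this
  refine ⟨⟨A₀.1, Matrix.mem_specialOrthogonalGroup_iff.2 ⟨A₀.2, hA₀⟩⟩, ⟨?_⟩⟩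
  exact
    { toFun := fun p => ⟨(H p).1, Matrix.mem_specialOrthogonalGroup_iff.2 ⟨(H p).2, hdet p⟩⟩
      continuous_toFun := (continuous_subtype_val.comp H.continuous).subtype_mk _
      map_zero_left := fun x => Subtype.ext (by
        show (H (0, x)).1 = (k x).1
        rw [H.apply_zero]
        rfl)
      map_one_left := fun x => Subtype.ext (by
        show (H (1, x)).1 = A₀.1
        rw [H.apply_one]
        rfl) }

end SpecialOrthogonal

/-! ### 6. On the sphere: null-homotopy of all maps into `SO(N)` versus `π_ n (SO(N), 1) = 0` -/

section Sphere

variable {N n : ℕ}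

/-- **In `SO(N)` all base points have the same homotopy groups as `1`**: if `π_ n (SO(N), 1)`
is trivial then so is `π_ n (SO(N), B)` for every `B` (the left translation `C ↦ B⁻¹ C` is a
homeomorphism taking `B` to `1`; the tree's `subsingleton_homotopyGroup_of_leftHomotopyInverse`).
[folklore] -/
theorem subsingleton_homotopyGroup_specialOrthogonalGroup_of_one
    (h : Subsingleton (π_ n (Matrix.specialOrthogonalGroup (Fin N) ℝ) 1))
    (B : Matrix.specialOrthogonalGroup (Fin N) ℝ) :
    Subsingleton (π_ n (Matrix.specialOrthogonalGroup (Fin N) ℝ) B) := by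
  let φ : C(Matrix.specialOrthogonalGroup (Fin N) ℝ, Matrix.specialOrthogonalGroup (Fin N) ℝ) :=
    ⟨fun C => B⁻¹ * C, continuous_const.mul continuous_id⟩
  let ψ : C(Matrix.specialOrthogonalGroup (Fin N) ℝ, Matrix.specialOrthogonalGroup (Fin N) ℝ) :=
    ⟨fun C => B * C, continuous_const.mul continuous_id⟩
  have hψφ : (ψ.comp φ).Homotopic (ContinuousMap.id _) := by
    rw [show ψ.comp φ = ContinuousMap.id _ from ContinuousMap.ext fun C => mul_inv_cancel_left B C]
  have hφB : φ B = 1 := inv_mul_cancel B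
  have h1 : Subsingleton (π_ n (Matrix.specialOrthogonalGroup (Fin N) ℝ) (φ B)) := by
    rw [hφB]
    exact h
  exact subsingleton_homotopyGroup_of_leftHomotopyInverse φ ψ hψφ B h1

/-- **`π_ n (SO(N), 1) = 0` implies that every continuous map `𝕊ⁿ → SO(N)` is null-homotopic**
(`n ≥ 1`): translate the map to be `1` at a point; it lands in the path component of `1` (the
sphere is path connected), which is path connected with all `π_ n` trivial
(`subsingleton_homotopyGroup_specialOrthogonalGroup_of_one`, `subsingleton_homotopyGroup_pathComponent`),
so Hatcher's criterion (3) ⇒ (1) for `πₙ = 0` (`homotopic_const_of_sphere_of_subsingleton_homotopyGroup`)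
makes it null-homotopic there; translate back. (For a path-connected H-space free and based
homotopy classes of maps `𝕊ⁿ → G` agree.) [cite: HatcherAT2002, §4.1 (p. 346, (3) ⇒ (1); p. 341)] -/
theorem nullhomotopic_specialOrthogonalGroup_of_subsingleton_homotopyGroup (hn : 1 ≤ n)
    (h : Subsingleton (π_ n (Matrix.specialOrthogonalGroup (Fin N) ℝ) 1))
    (k : C(sphere (0 : EuclideanSpace ℝ (Fin (n + 1))) 1, Matrix.specialOrthogonalGroup (Fin N) ℝ)) :
    k.Nullhomotopic := by
  let u₀ : sphere (0 : EuclideanSpace ℝ (Fin (n + 1))) 1 := ⟨EuclideanSpace.single 0 1, by simp⟩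
  have hrk : 1 < Module.rank ℝ (EuclideanSpace ℝ (Fin (n + 1))) := by
    rw [← Module.finrank_eq_rank, finrank_euclideanSpace_fin]
    exact_mod_cast Nat.lt_succ_of_le hn
  haveI : PathConnectedSpace (sphere (0 : EuclideanSpace ℝ (Fin (n + 1))) 1) :=
    isPathConnected_iff_pathConnectedSpace.mp (isPathConnected_sphere hrk 0 zero_le_one)
  -- base the map at `1`
  let A : Matrix.specialOrthogonalGroup (Fin N) ℝ := k u₀
  let k₁ : C(sphere (0 : EuclideanSpace ℝ (Fin (n + 1))) 1, Matrix.specialOrthogonalGroup (Fin N) ℝ) :=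
    ⟨fun u => A⁻¹ * k u, continuous_const.mul k.continuous⟩
  have hk₁ : k₁ u₀ = 1 := inv_mul_cancel A
  -- into the path component of `1`
  haveI : PathConnectedSpace ↥(pathComponent (1 : Matrix.specialOrthogonalGroup (Fin N) ℝ)) :=
    isPathConnected_iff_pathConnectedSpace.mp isPathConnected_pathComponent
  have hmem : ∀ u, k₁ u ∈ pathComponent (1 : Matrix.specialOrthogonalGroup (Fin N) ℝ) := fun u => by
    have : k₁ u ∈ pathComponent (k₁ u₀) := ⟨(PathConnectedSpace.somePath u₀ u).map k₁.continuous⟩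
    rwa [hk₁] at this
  let k₂ : C(sphere (0 : EuclideanSpace ℝ (Fin (n + 1))) 1,
      ↥(pathComponent (1 : Matrix.specialOrthogonalGroup (Fin N) ℝ))) :=
    ⟨fun u => ⟨k₁ u, hmem u⟩, k₁.continuous.subtype_mk _⟩
  have hπ : 1 ≤ n → ∀ z : ↥(pathComponent (1 : Matrix.specialOrthogonalGroup (Fin N) ℝ)),
      Subsingleton (π_ n (↥(pathComponent (1 : Matrix.specialOrthogonalGroup (Fin N) ℝ))) z) :=
    fun _ z => subsingleton_homotopyGroup_pathComponent (1 : Matrix.specialOrthogonalGroup (Fin N) ℝ)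
      z (subsingleton_homotopyGroup_specialOrthogonalGroup_of_one h z)
  have hk₂ : k₂.Homotopic (ContinuousMap.const _ ⟨1, mem_pathComponent_self 1⟩) :=
    homotopic_const_of_sphere_of_subsingleton_homotopyGroup (E := EuclideanSpace ℝ (Fin (n + 1)))
      (m := n) finrank_euclideanSpace_fin hπ k₂ _
  -- unwind the translation
  have hval : (⟨Subtype.val, continuous_subtype_val⟩ :
      C(↥(pathComponent (1 : Matrix.specialOrthogonalGroup (Fin N) ℝ)),
        Matrix.specialOrthogonalGroup (Fin N) ℝ)).comp k₂ = k₁ :=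
    ContinuousMap.ext fun _ => rfl
  have h1 : k₁.Nullhomotopic :=
    ⟨1, by rw [← hval]; exact (ContinuousMap.Homotopic.refl _).comp hk₂⟩
  let L : C(Matrix.specialOrthogonalGroup (Fin N) ℝ, Matrix.specialOrthogonalGroup (Fin N) ℝ) :=
    ⟨fun C => A * C, continuous_const.mul continuous_id⟩
  have hL : L.comp k₁ = k := ContinuousMap.ext fun u => mul_inv_cancel_left A (k u)
  obtain ⟨C₀, hC₀⟩ := h1
  exact ⟨L C₀, by rw [← hL]; exact (ContinuousMap.Homotopic.refl L).comp hC₀⟩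

/-- **Conversely, if every continuous map `𝕊ⁿ → SO(N)` is null-homotopic then
`π_ n (SO(N), 1) = 0`** (the tree's `subsingleton_homotopyGroup_of_sphereMaps_nullhomotopic`:
cube classes factor through `Iⁿ/∂Iⁿ ≅ 𝕊ⁿ`, free null-homotopies give based ones; Hatcher §4.1,
p. 346, (1) ⇒ (3)). [cite: HatcherAT2002, §4.1 (p. 346, (1) ⇒ (3))] -/
theorem subsingleton_homotopyGroup_specialOrthogonalGroup_of_nullhomotopic
    (h : ∀ k : C(sphere (0 : EuclideanSpace ℝ (Fin (n + 1))) 1,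
      Matrix.specialOrthogonalGroup (Fin N) ℝ), k.Nullhomotopic) :
    Subsingleton (π_ n (Matrix.specialOrthogonalGroup (Fin N) ℝ) 1) :=
  subsingleton_homotopyGroup_of_sphereMaps_nullhomotopic (N := n) h 1

end Sphere

/-! ### 7. Stable frames of `ℝᵐ` versus linearly independent families of `ℝᵐ⁺¹` -/

section Transport

variable {X : Type*} [TopologicalSpace X] {m : ℕ}

/-- **Null-homotopy of all maps into `StableFrame m`** (linearly independent `(m + 1)`-families
of `ℝᵐ × ℝ`) **iff of all maps into the linearly independent `(m + 1)`-families of `ℝᵐ⁺¹`**: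
transport along a linear homeomorphism `ℝᵐ × ℝ ≅ ℝᵐ⁺¹` (`ContinuousLinearEquiv.ofFinrankEq`;
the "coordinates in a basis" of the docstring of `StableFrame`), which preserves linear
independence. [folklore] -/
theorem nullhomotopic_stableFrame_iff :
    (∀ f : C(X, StableFrame m), f.Nullhomotopic) ↔
      ∀ g : C(X, {v : Fin (m + 1) → EuclideanSpace ℝ (Fin (m + 1)) // LinearIndependent ℝ v}),
        g.Nullhomotopic := by
  have hfin : Module.finrank ℝ (EuclideanSpace ℝ (Fin m) × ℝ) =
      Module.finrank ℝ (EuclideanSpace ℝ (Fin (m + 1))) := by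
    simp [Module.finrank_prod]
  let e : (EuclideanSpace ℝ (Fin m) × ℝ) ≃L[ℝ] EuclideanSpace ℝ (Fin (m + 1)) :=
    ContinuousLinearEquiv.ofFinrankEq hfin
  let fwd : C(StableFrame m,
      {v : Fin (m + 1) → EuclideanSpace ℝ (Fin (m + 1)) // LinearIndependent ℝ v}) :=
    ⟨fun v => ⟨(e.toLinearEquiv : _ →ₗ[ℝ] _) ∘ v.1, v.2.map' _ e.toLinearEquiv.ker⟩,
      (continuous_pi fun j => e.continuous.comp
        ((continuous_apply j).comp continuous_subtype_val)).subtype_mk _⟩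
  let bwd : C({v : Fin (m + 1) → EuclideanSpace ℝ (Fin (m + 1)) // LinearIndependent ℝ v},
      StableFrame m) :=
    ⟨fun w => ⟨(e.symm.toLinearEquiv : _ →ₗ[ℝ] _) ∘ w.1, w.2.map' _ e.symm.toLinearEquiv.ker⟩,
      (continuous_pi fun j => e.symm.continuous.comp
        ((continuous_apply j).comp continuous_subtype_val)).subtype_mk _⟩
  have h1 : bwd.comp fwd = ContinuousMap.id _ :=
    ContinuousMap.ext fun v => Subtype.ext (funext fun j => by simp [fwd, bwd])
  have h2 : fwd.comp bwd = ContinuousMap.id _ :=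
    ContinuousMap.ext fun w => Subtype.ext (funext fun j => by simp [fwd, bwd])
  constructor
  · intro h g
    obtain ⟨y, hy⟩ := h (bwd.comp g)
    have hg : g = fwd.comp (bwd.comp g) := by
      rw [← ContinuousMap.comp_assoc, h2, ContinuousMap.id_comp]
    exact ⟨fwd y, by rw [hg]; exact (ContinuousMap.Homotopic.refl fwd).comp hy⟩
  · intro h f
    obtain ⟨y, hy⟩ := h (fwd.comp f)
    have hf : f = bwd.comp (fwd.comp f) := by
      rw [← ContinuousMap.comp_assoc, h1, ContinuousMap.id_comp]
    exact ⟨bwd y, by rw [hf]; exact (ContinuousMap.Homotopic.refl bwd).comp hy⟩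

end Transport

/-! ### 8. Assembly: the extension property is `π_ n (SO(n + 2), 1) = 0` -/

/-- **The extension property `SphereMapsToStableFramesExtend n` is exactly
`π_ n (SO(n + 2), 1) = 0`** (`n ≥ 1`), for Mathlib's `HomotopyGroup (Fin n)` of
`Matrix.specialOrthogonalGroup (Fin (n + 2)) ℝ` at the base point `1`: the chain §4–§7 of this
file after `sphereMapsToStableFramesExtend_iff_nullhomotopic` (extension over `ℝⁿ⁺¹` iff
null-homotopic, Hatcher §4.1 p. 346 (1) ⇔ (2)). This is the formal content of the sentence
"each path component of `GL(n + 2, ℝ)` is homeomorphic to `GL⁺(n + 2, ℝ)`, which deformation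
retracts onto `SO(n + 2)`; a map of the connected `𝕊ⁿ` lands in one component and extends over
the disc iff it is null-homotopic, which is automatic when `πₙ(SO(n + 2)) = 0`" in the docstring
of `SphereMapsToStableFramesExtend`, with the converse.
[cite: HatcherAT2002, §3.D and §4.1 (p. 346)] -/
theorem sphereMapsToStableFramesExtend_iff_subsingleton_homotopyGroup_specialOrthogonalGroup
    {n : ℕ} (hn : 1 ≤ n) :
    SphereMapsToStableFramesExtend n ↔
      Subsingleton (π_ n (Matrix.specialOrthogonalGroup (Fin (n + 2)) ℝ) 1) := by
  have hrk : 1 < Module.rank ℝ (EuclideanSpace ℝ (Fin (n + 1))) := by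
    rw [← Module.finrank_eq_rank, finrank_euclideanSpace_fin]
    exact_mod_cast Nat.lt_succ_of_le hn
  haveI : PreconnectedSpace (sphere (0 : EuclideanSpace ℝ (Fin (n + 1))) 1) :=
    Subtype.preconnectedSpace (isPreconnected_sphere hrk 0 1)
  haveI : Nonempty (sphere (0 : EuclideanSpace ℝ (Fin (n + 1))) 1) :=
    ⟨⟨EuclideanSpace.single 0 1, by simp⟩⟩
  rw [sphereMapsToStableFramesExtend_iff_nullhomotopic, nullhomotopic_stableFrame_iff]
  constructor
  · intro hLIF
    exact subsingleton_homotopyGroup_specialOrthogonalGroup_of_nullhomotopic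
      (nullhomotopic_specialOrthogonalGroup_of_orthogonalGroup
        (nullhomotopic_orthogonalGroup_of_linearIndependent hLIF))
  · intro hπ
    exact nullhomotopic_linearIndependent_of_orthogonalGroup
      (nullhomotopic_orthogonalGroup_of_specialOrthogonalGroup
        (nullhomotopic_specialOrthogonalGroup_of_subsingleton_homotopyGroup hn hπ))

/-- **`π₆(SO(8), 1) = 0` in Mathlib's vocabulary implies the named fact
`Bott1959_sphereMapsToStableFramesExtend_six`.** This is the form in which the printed sources
state it — Bott 1959, §1, Corollary to Thm. II, (1.5): `πₖ(O) = πₖ₊₄(Sp)`, `π₂(Sp) = 0`, "the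
period of `π_*(O)` is `ℤ₂, ℤ₂, 0, ℤ, 0, 0, 0, ℤ`" (p. 315), so `π₆(SO) = π₆(O) = 0`; and the
stability `π₆(SO(8)) ≅ π₆(SO)` (Kosinski, Appendix §5, p. 230, table (5.1); Kervaire–Milnor
p. 508) — and the direction a future computation of `π_ 6 (SO(8)) 1` for Mathlib's
`HomotopyGroup` feeds. [cite: Bott1959, §1, Corollary to Thm. II, (1.5), p. 315 (π₆(O) = π₂(Sp) = 0)]
[cite: Kosinski1993, Appendix §5, (5.1) and p. 230 (π₆(SO(8)) ≅ π₆(SO))]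
[cite: KervaireMilnorAnnals1963, §3, proof of Thm. 3.1, p. 508] -/
theorem Bott1959_sphereMapsToStableFramesExtend_six_of_specialOrthogonalGroup
    (h : Subsingleton (π_ 6 (Matrix.specialOrthogonalGroup (Fin 8) ℝ) 1)) :
    Bott1959_sphereMapsToStableFramesExtend_six :=
  (sphereMapsToStableFramesExtend_iff_subsingleton_homotopyGroup_specialOrthogonalGroup
    (n := 6) (by norm_num)).2 h

/-- **The named fact implies `π₆(SO(8), 1) = 0`** for Mathlib's `HomotopyGroup (Fin 6)` of
`Matrix.specialOrthogonalGroup (Fin 8) ℝ`. [cite: Bott1959, §1, Corollary to Thm. II, (1.5), p. 315]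
[cite: HatcherAT2002, §3.D and §4.1 (p. 346)] -/
theorem subsingleton_homotopyGroup_specialOrthogonalGroup_of_Bott1959_sphereMapsToStableFramesExtend_six
    (h : Bott1959_sphereMapsToStableFramesExtend_six) :
    Subsingleton (π_ 6 (Matrix.specialOrthogonalGroup (Fin 8) ℝ) 1) :=
  (sphereMapsToStableFramesExtend_iff_subsingleton_homotopyGroup_specialOrthogonalGroup
    (n := 6) (by norm_num)).1 h

/-- **The named fact `Bott1959_sphereMapsToStableFramesExtend_six` is exactly
`π₆(SO(8), 1) = 0`**: `SphereMapsToStableFramesExtend 6 ↔ Subsingleton (π_ 6 SO(8) 1)` with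
`SO(8) = Matrix.specialOrthogonalGroup (Fin 8) ℝ` — the printed statement (Bott 1959, §1,
Corollary to Thm. II, (1.5) and the table after it, p. 315: `π₆(O) = 0`; stability
`π₆(SO(8)) ≅ π₆(SO)`, Kosinski, Appendix p. 230 and (5.1); the translation of Hatcher §3.D,
§4.1). [cite: Bott1959, §1, Corollary to Thm. II, (1.5), p. 315 (π₆(O) = 0)]
[cite: Kosinski1993, Appendix §5, (5.1) and p. 230] [cite: HatcherAT2002, §3.D and §4.1 (p. 346)] -/
theorem Bott1959_sphereMapsToStableFramesExtend_six_iff_specialOrthogonalGroup :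
    Bott1959_sphereMapsToStableFramesExtend_six ↔
      Subsingleton (π_ 6 (Matrix.specialOrthogonalGroup (Fin 8) ℝ) 1) :=
  sphereMapsToStableFramesExtend_iff_subsingleton_homotopyGroup_specialOrthogonalGroup
    (n := 6) (by norm_num)

end Literature.Topology.FourManifolds

end
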